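import Summits.AtomisticToContinuum.Crystallization.Theorems.FrustratedLawDichotomyDRowsBccSound
import Summits.AtomisticToContinuum.Crystallization.Theorems.FrustratedLawDichotomyDRowsAssembly
import Summits.AtomisticToContinuum.Crystallization.Theorems.FrustratedLawDichotomyDRowsRegroup
import Literature.Barriers.AtomisticToContinuum.NoUniversallyOptimalLattice3DProofs

/-!
# DROWS-SOUND closed for the bcc chunk: the perfect bcc template is NOT an energy minimiser on its scale window

decomp-a2c hand-2 g46 — structural share for `AperiodicFrustratedLawGap` (stmt-27623), class-D rows (critic r1757 (C)(b) «DROWS-SOUND»).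
This file supplies piece (s1) for the bcc template and composes the whole chain:

* the template: `bccTemplate s = {scaledIntPoint (s/√3) v | v ∈ ℤ³, v₀ ≡ v₁ ≡ v₂ (mod 2)}` — the body-centred cubic point set `2ℤ³ ∪ (2ℤ³ + (1,1,1))`
  in census's integer frame (squared NN distance `3`), scaled to nearest-neighbour distance `s` and rooted at an atom (Literature
  `scaledIntPoint`; same parity description as Literature `bccUnitDensity`);
* (s1) = three finite facts about the frame box `[-19, 19]³` against census's certified histogram `H0`: `cover_H0` (every frame point of squared
  length `< 375` sits on a booked shell) and `nodup_H0` by `decide +kernel` here, and FIBRES (every booked shell has exactly the booked number of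
  frame points) as the ONE explicit hypothesis of the final theorem (its kernel-shaped count is a K-lane item),
  the parity-lattice minimum `3 ≤ |v|²` (separation `s`), and the far-atom bound (frame points outside the window are `≥ R_i = 10·s_i/s_{i+1}` away);
* composition: `…DRowsRegroup.sum_key_eq_histogram` (true window sum = booked sum) + `…DRowsAssembly.sum_phiT_sub_env_le_two_mul_rootEnergy`
  (window + tail ≤ 2·rootEnergy) + `…DRowsBccSound.drows_bcc_sound` (the K certificate over `ℝ`, (s2)(s3)(s4)(s5)).

★ `bcc_rootEnergy_floor_of_fibres`: given FIBRES, for every leaf `i < 128` and every `s ∈ [sNum i/sDen, sNum (i+1)/sDen]` (the window `s/s⋆ ∈ [0.94, 1.06]`,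
`s⋆ = 0.95192`): `e⋆ + 27/1000 ≤ rootEnergy V_LJ (count⌊bccTemplate s)` — the root energy of the perfect bcc template exceeds the periodic
infimum by at least `0.027` throughout the window, as a theorem about the tree's `rootEnergy`.
Definitions: `bccTemplate`, `toVec`, `nsq`, `bccBox`, `winBox` (the last four are the finite frame bookkeeping of (s1)).
-/

namespace Summit.AtomisticToContinuum.Crystallization.Theorems.FrustratedLawDichotomyDRowsBccTemplate

open MeasureTheory Metric Set
open scoped BigOperators
open Literature.MathematicalPhysics.StatisticalMechanics (lennardJones rootEnergy)
open Literature.Barriers.AtomisticToContinuum (scaledIntPoint scaledIntPoint_apply norm_scaledIntPoint_sq scaledIntPoint_injective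
  scaledIntPoint_zero)
open Summit.AtomisticToContinuum.Crystallization.Theorems.ChargedEnergyGapNegative (E3 eStar)
open Summit.AtomisticToContinuum.Crystallization.Theorems.FrustratedLawDichotomyDRowsBcc (H0 sNum sDen xnum XD)
open Summit.AtomisticToContinuum.Crystallization.Theorems.FrustratedLawDichotomyCoherentFloorAlgebra (phiT)
open Summit.AtomisticToContinuum.Crystallization.Theorems.FrustratedLawDichotomyDRowsBccSound (drows_bcc_sound sNum_pos sDen_pos)
open Summit.AtomisticToContinuum.Crystallization.Theorems.FrustratedLawDichotomyDRowsAssembly (sum_phiT_sub_env_le_two_mul_rootEnergy)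
open Summit.AtomisticToContinuum.Crystallization.Theorems.FrustratedLawDichotomyDRowsRegroup (sum_key_eq_histogram)

/-! ## §1 The template and its integer frame -/

/-- **The bcc template at nearest-neighbour distance `s`, rooted at an atom**: the frame `{v ∈ ℤ³ : v₀ ≡ v₁ ≡ v₂ (2)}` (squared NN distance `3`)
scaled by `s/√3`. -/
def bccTemplate (s : ℝ) : Set E3 :=
  {x | ∃ v : Fin 3 → ℤ, (v 0 % 2 = v 1 % 2 ∧ v 1 % 2 = v 2 % 2) ∧ x = scaledIntPoint (s / Real.sqrt 3) v}

/-- a frame triple as a vector. -/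
def toVec (m : ℤ × ℤ × ℤ) : Fin 3 → ℤ := ![m.1, m.2.1, m.2.2]

/-- squared frame length of a triple. -/
def nsq (m : ℤ × ℤ × ℤ) : ℤ := m.1 * m.1 + m.2.1 * m.2.1 + m.2.2 * m.2.2

/-- the nonzero frame points of the template in the box `[-19, 19]³` (every frame point of squared length `< 375` lies in it). -/
noncomputable def bccBox : Finset (ℤ × ℤ × ℤ) :=
  ((Finset.Icc (-19 : ℤ) 19) ×ˢ ((Finset.Icc (-19 : ℤ) 19) ×ˢ (Finset.Icc (-19 : ℤ) 19))).filter
    fun m => (m.1 % 2 = m.2.1 % 2 ∧ m.2.1 % 2 = m.2.2 % 2) ∧ m ≠ 0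

/-- the frame points inside the cut of leaf `i` (census's test `sNum (i+1)²·D < 100·3·sDen²` verbatim). -/
noncomputable def winBox (i : ℕ) : Finset (ℤ × ℤ × ℤ) :=
  bccBox.filter fun m => sNum (i + 1) * sNum (i + 1) * nsq m < 100 * (3 * sDen * sDen)

/-- coordinate `0` of `toVec`. -/
@[simp] theorem toVec_zero (m : ℤ × ℤ × ℤ) : toVec m 0 = m.1 := rfl
/-- coordinate `1` of `toVec`. -/
@[simp] theorem toVec_one (m : ℤ × ℤ × ℤ) : toVec m 1 = m.2.1 := rfl
/-- coordinate `2` of `toVec`. -/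
@[simp] theorem toVec_two (m : ℤ × ℤ × ℤ) : toVec m 2 = m.2.2 := rfl

/-- `toVec` is injective. -/
theorem toVec_injective : Function.Injective toVec := by
  intro m m' h
  have h0 := congrFun h 0; have h1 := congrFun h 1; have h2 := congrFun h 2
  simp only [toVec_zero, toVec_one, toVec_two] at h0 h1 h2
  exact Prod.ext h0 (Prod.ext h1 h2)

/-- every frame vector is `toVec` of its coordinate triple. -/
theorem toVec_triple (v : Fin 3 → ℤ) : toVec (v 0, v 1, v 2) = v := by
  funext j; fin_cases j <;> rfl

/-- the zero triple maps to the zero vector. -/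
theorem toVec_zero' : toVec 0 = 0 := by funext j; fin_cases j <;> rfl

/-- squared norm of a scaled frame point: `‖scaledIntPoint t (toVec m)‖² = t²·nsq m`. -/
theorem norm_sq_toVec (t : ℝ) (m : ℤ × ℤ × ℤ) : ‖scaledIntPoint t (toVec m)‖ ^ 2 = t ^ 2 * (nsq m : ℝ) := by
  rw [norm_scaledIntPoint_sq, Fin.sum_univ_three, toVec_zero, toVec_one, toVec_two, nsq]
  push_cast; ring

/-- `nsq` is a sum of squares. -/
theorem nsq_nonneg (m : ℤ × ℤ × ℤ) : 0 ≤ nsq m := by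
  unfold nsq; nlinarith [mul_self_nonneg m.1, mul_self_nonneg m.2.1, mul_self_nonneg m.2.2]

/-- differences of scaled frame points are scaled frame points. -/
theorem scaledIntPoint_sub (t : ℝ) (v w : Fin 3 → ℤ) : scaledIntPoint t v - scaledIntPoint t w = scaledIntPoint t (v - w) := by
  ext i
  simp only [PiLp.sub_apply, scaledIntPoint_apply, Pi.sub_apply, Int.cast_sub]
  ring

/-- ★ the parity frame has no nonzero vector of squared length `< 3`. -/
theorem three_le_nsq_of_par {a b c : ℤ} (hab : a % 2 = b % 2) (hbc : b % 2 = c % 2) (h : ¬(a = 0 ∧ b = 0 ∧ c = 0)) :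
    3 ≤ a * a + b * b + c * c := by
  rcases Int.emod_two_eq_zero_or_one a with ha | ha
  · -- all even, not all zero: one coordinate has absolute value ≥ 2
    have hb : b % 2 = 0 := hab ▸ ha
    have hc : c % 2 = 0 := hbc ▸ hb
    obtain ⟨k, rfl⟩ := Int.dvd_of_emod_eq_zero ha
    obtain ⟨l, rfl⟩ := Int.dvd_of_emod_eq_zero hb
    obtain ⟨n, rfl⟩ := Int.dvd_of_emod_eq_zero hc
    have hkln : ¬(k = 0 ∧ l = 0 ∧ n = 0) := fun ⟨h1, h2, h3⟩ => h ⟨by simp [h1], by simp [h2], by simp [h3]⟩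
    have hpos : 1 ≤ k * k + l * l + n * n := by
      by_contra hlt
      have hk : k * k = 0 := by nlinarith [mul_self_nonneg k, mul_self_nonneg l, mul_self_nonneg n]
      have hl : l * l = 0 := by nlinarith [mul_self_nonneg k, mul_self_nonneg l, mul_self_nonneg n]
      have hn : n * n = 0 := by nlinarith [mul_self_nonneg k, mul_self_nonneg l, mul_self_nonneg n]
      exact hkln ⟨mul_self_eq_zero.mp hk, mul_self_eq_zero.mp hl, mul_self_eq_zero.mp hn⟩
    nlinarith
  · -- all odd: every coordinate is nonzero
    have hb : b % 2 = 1 := hab ▸ ha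
    have hc : c % 2 = 1 := hbc ▸ hb
    have ha0 : a ≠ 0 := by rintro rfl; simp at ha
    have hb0 : b ≠ 0 := by rintro rfl; simp at hb
    have hc0 : c ≠ 0 := by rintro rfl; simp at hc
    have h1 : 1 ≤ a * a := by nlinarith [Int.one_le_abs ha0, abs_mul_abs_self a]
    have h2 : 1 ≤ b * b := by nlinarith [Int.one_le_abs hb0, abs_mul_abs_self b]
    have h3 : 1 ≤ c * c := by nlinarith [Int.one_le_abs hc0, abs_mul_abs_self c]
    linarith

/-- ★ the bcc template at NN distance `s > 0` is `s`-separated. -/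
theorem bccTemplate_separated {s : ℝ} (hs : 0 < s) :
    ∀ p ∈ bccTemplate s, ∀ p' ∈ bccTemplate s, p ≠ p' → s ≤ dist p p' := by
  rintro p ⟨v, hv, rfl⟩ p' ⟨w, hw, rfl⟩ hne
  rw [dist_eq_norm, scaledIntPoint_sub]
  set u : Fin 3 → ℤ := v - w with hu
  have hu0 : ¬(u 0 = 0 ∧ u 1 = 0 ∧ u 2 = 0) := by
    rintro ⟨h0, h1, h2⟩
    apply hne
    have : v = w := by
      funext j; fin_cases j
      · simpa [hu, sub_eq_zero] using h0
      · simpa [hu, sub_eq_zero] using h1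
      · simpa [hu, sub_eq_zero] using h2
    rw [this]
  have hpar : u 0 % 2 = u 1 % 2 ∧ u 1 % 2 = u 2 % 2 := by
    simp only [hu, Pi.sub_apply]
    constructor <;> omega
  have hint := three_le_nsq_of_par hpar.1 hpar.2 hu0
  have hsq : s ^ 2 ≤ ‖scaledIntPoint (s / Real.sqrt 3) u‖ ^ 2 := by
    rw [norm_scaledIntPoint_sq, Fin.sum_univ_three, div_pow, Real.sq_sqrt (by norm_num : (0 : ℝ) ≤ 3)]
    have : (3 : ℝ) ≤ (u 0 : ℝ) ^ 2 + (u 1 : ℝ) ^ 2 + (u 2 : ℝ) ^ 2 := by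
      have := (Int.cast_le (R := ℝ)).mpr hint
      push_cast at this; nlinarith
    nlinarith [sq_nonneg s]
  exact (pow_le_pow_iff_left₀ hs.le (norm_nonneg _) two_ne_zero).mp hsq

/-- the root belongs to the template. -/
theorem zero_mem_bccTemplate (s : ℝ) : (0 : E3) ∈ bccTemplate s := ⟨0, by simp, (scaledIntPoint_zero _).symm⟩

/-! ## §2 The kernel facts of (s1) -/

/-- (s1, NODUP) the shells of `H0` are pairwise distinct. -/
theorem nodup_H0 : (H0.map Prod.fst).Nodup := by decide +kernel

/-- (s1, FIBRES) — the ONE finite counting fact this file takes as a HYPOTHESIS (`FibresH0` below): every shell `(D, m)` booked in census's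
`H0` carries exactly `m` nonzero frame points of squared length `D` in the box `[-19,19]³`.  (It is a closed, decidable statement; the direct
`decide +kernel` on `Finset.filter/card` stalls in this toolchain, so the kernel-shaped count is left to the K lane — see the STATUS note.) -/
theorem fibresH0_iff : (∀ Dm ∈ H0, (bccBox.filter fun m => nsq m = (Dm.1 : ℤ)).card = Dm.2) ↔
    (∀ Dm ∈ H0, (bccBox.filter fun m => nsq m = (Dm.1 : ℤ)).card = Dm.2) := Iff.rfl

/-- (s1, COVER) every nonzero frame point of the box of squared length `< 375` sits on a booked shell. -/
theorem cover_H0 : ∀ m ∈ bccBox, nsq m < 375 → (nsq m).toNat ∈ H0.map Prod.fst := by decide +kernel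

/-! ## §3 Arithmetic of the scale window -/

/-- `sDen = 1.28·10⁹`. -/
theorem sDen_eq : sDen = 1280000000 := by unfold sDen XD; norm_num

/-- the upper end of every leaf is at least `sNum 1 = 95192·12044`. -/
theorem sNum_succ_ge (i : ℕ) : 1146492448 ≤ sNum (i + 1) := by unfold sNum xnum; push_cast; omega

/-- consecutive leaf ends are within a factor `10` (indeed `1.001`): `sNum (i+1) ≤ 10·sNum i`. -/
theorem sNum_succ_le (i : ℕ) : sNum (i + 1) ≤ 10 * sNum i := by unfold sNum xnum; push_cast; omega

/-- leaf ends are below `20·sDen`. -/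
theorem sNum_le (i : ℕ) (hi : i < 200) : sNum (i + 1) ≤ 20 * sDen := by rw [sDen_eq]; unfold sNum xnum; push_cast; omega

/-- a shell inside the cut of any leaf has squared frame length `< 375`. -/
theorem nsq_lt_of_inside {i : ℕ} {D : ℤ} (hD : sNum (i + 1) * sNum (i + 1) * D < 100 * (3 * sDen * sDen)) : D < 375 := by
  by_contra hge
  push Not at hge
  have h1 := sNum_succ_ge i
  have h2 : (1146492448 : ℤ) * 1146492448 ≤ sNum (i + 1) * sNum (i + 1) := mul_le_mul h1 h1 (by norm_num) (by linarith)
  have h3 : sNum (i + 1) * sNum (i + 1) * 375 ≤ sNum (i + 1) * sNum (i + 1) * D := mul_le_mul_of_nonneg_left hge (by nlinarith)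
  rw [sDen_eq] at hD
  nlinarith

/-- a frame point NOT inside the cut is at squared distance `≥ R_i²·3/s²`-worth: `300·sDen² ≤ sNum(i+1)²·nsq` — either by the failed test
inside the box, or because a coordinate is `≥ 20` in absolute value outside it. -/
theorem far_of_not_mem_winBox {i : ℕ} {m : ℤ × ℤ × ℤ} (hpar : m.1 % 2 = m.2.1 % 2 ∧ m.2.1 % 2 = m.2.2 % 2) (hm0 : m ≠ 0)
    (hw : m ∉ winBox i) : 100 * (3 * sDen * sDen) ≤ sNum (i + 1) * sNum (i + 1) * nsq m := by
  by_cases hbox : m ∈ bccBox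
  · by_contra hlt
    push Not at hlt
    exact hw (Finset.mem_filter.mpr ⟨hbox, hlt⟩)
  · -- outside the box: a coordinate has absolute value ≥ 20
    have hnot : ¬(m.1 ∈ Finset.Icc (-19 : ℤ) 19 ∧ m.2.1 ∈ Finset.Icc (-19 : ℤ) 19 ∧ m.2.2 ∈ Finset.Icc (-19 : ℤ) 19) := by
      intro h
      exact hbox (Finset.mem_filter.mpr ⟨Finset.mem_product.mpr ⟨h.1, Finset.mem_product.mpr ⟨h.2.1, h.2.2⟩⟩, hpar, hm0⟩)
    simp only [Finset.mem_Icc, not_and_or, not_le] at hnot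
    have h400 : 400 ≤ nsq m := by
      unfold nsq
      rcases hnot with (h | h) | (h | h) | (h | h) <;>
        nlinarith [mul_self_nonneg m.1, mul_self_nonneg m.2.1, mul_self_nonneg m.2.2]
    have h1 := sNum_succ_ge i
    have h2 : (1146492448 : ℤ) * 1146492448 ≤ sNum (i + 1) * sNum (i + 1) := mul_le_mul h1 h1 (by norm_num) (by linarith)
    have h3 : sNum (i + 1) * sNum (i + 1) * 400 ≤ sNum (i + 1) * sNum (i + 1) * nsq m := mul_le_mul_of_nonneg_left h400 (by nlinarith)
    rw [sDen_eq]
    nlinarith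

/-! ## §4 ★ The bcc row floor -/

/-- window atoms of leaf `i` at scale `s`: the scaled images of the frame points inside the cut. -/
theorem mem_image_winBox {i : ℕ} {t : ℝ} {z : E3} :
    z ∈ (winBox i).image (fun m => scaledIntPoint t (toVec m)) ↔ ∃ m ∈ winBox i, scaledIntPoint t (toVec m) = z := Finset.mem_image

/-- ★★★ **DROWS-SOUND, bcc: the perfect bcc template is not a minimiser on its scale window** (given the finite counting fact FIBRES).
For every leaf `i < 128` and every nearest-neighbour distance `s ∈ [sNum i/sDen, sNum (i+1)/sDen]` (together `s ∈ [0.8948, 1.0091]`, i.e.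
`s/s⋆ ∈ [0.94, 1.06]`): `e⋆ + 27/1000 ≤ rootEnergy V_LJ (count⌊bccTemplate s)`. [this route] -/
theorem bcc_rootEnergy_floor_of_fibres (hfib : ∀ Dm ∈ H0, (bccBox.filter fun m => nsq m = (Dm.1 : ℤ)).card = Dm.2)
    {i : ℕ} (hi : i < 128) {s : ℝ} (hs1 : (sNum i : ℝ) / sDen ≤ s) (hs2 : s ≤ (sNum (i + 1) : ℝ) / sDen) :
    eStar + 27 / 1000 ≤ rootEnergy lennardJones (Measure.count.restrict (bccTemplate s) : Measure E3) := by
  classical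
  -- the scale data
  have hDpos : (0 : ℝ) < sDen := by exact_mod_cast sDen_pos
  have hlo : (0 : ℝ) < sNum i := by exact_mod_cast sNum_pos i
  have hhi : (0 : ℝ) < sNum (i + 1) := by exact_mod_cast sNum_pos (i + 1)
  have hδ0 : (0 : ℝ) < (sNum i : ℝ) / sDen := div_pos hlo hDpos
  have hs0 : 0 < s := hδ0.trans_le hs1
  have h3 : (0 : ℝ) < Real.sqrt 3 := Real.sqrt_pos.mpr (by norm_num)
  have ht0 : 0 < s / Real.sqrt 3 := div_pos hs0 h3
  have ht2 : (s / Real.sqrt 3) ^ 2 = s ^ 2 / 3 := by rw [div_pow, Real.sq_sqrt (by norm_num : (0 : ℝ) ≤ 3)]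
  have h10 : (sNum (i + 1) : ℝ) ≤ 10 * sNum i := by
    have := (Int.cast_le (R := ℝ)).mpr (sNum_succ_le i); push_cast at this; exact this
  have h20 : (sNum (i + 1) : ℝ) ≤ 20 * sDen := by
    have := (Int.cast_le (R := ℝ)).mpr (sNum_le i (by omega)); push_cast at this; exact this
  have hR1 : (1 : ℝ) ≤ 10 * (sNum i : ℝ) / sNum (i + 1) := by rw [le_div_iff₀ hhi]; linarith
  have hR0 : (0 : ℝ) ≤ 10 * (sNum i : ℝ) / sNum (i + 1) := zero_le_one.trans hR1
  have hRδ : (sNum i : ℝ) / sDen / 2 ≤ 10 * (sNum i : ℝ) / sNum (i + 1) := by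
    rw [div_div, div_le_div_iff₀ (mul_pos hDpos two_pos) hhi]; nlinarith
  -- the window atoms
  have hfinj : Function.Injective fun m : ℤ × ℤ × ℤ => scaledIntPoint (s / Real.sqrt 3) (toVec m) :=
    fun m m' h => toVec_injective (scaledIntPoint_injective ht0.ne' h)
  -- hypotheses of the window/tail lemma
  have hsep : ∀ p ∈ bccTemplate s, ∀ p' ∈ bccTemplate s, p ≠ p' → (sNum i : ℝ) / sDen ≤ dist p p' :=
    fun p hp p' hp' hne => hs1.trans (bccTemplate_separated hs0 p hp p' hp' hne)
  have hWS : (↑((winBox i).image fun m => scaledIntPoint (s / Real.sqrt 3) (toVec m)) : Set E3) ⊆ bccTemplate s := by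
    intro z hz
    obtain ⟨m, hm, rfl⟩ := mem_image_winBox.mp (Finset.mem_coe.mp hz)
    have hm' := (Finset.mem_filter.mp (Finset.mem_filter.mp hm).1).2.1
    exact ⟨toVec m, by simpa using hm', rfl⟩
  have h0W : (0 : E3) ∉ (winBox i).image fun m => scaledIntPoint (s / Real.sqrt 3) (toVec m) := by
    intro h0
    obtain ⟨m, hm, hm0⟩ := mem_image_winBox.mp h0
    have hmne := (Finset.mem_filter.mp (Finset.mem_filter.mp hm).1).2.2
    apply hmne
    apply toVec_injective
    rw [toVec_zero']
    apply scaledIntPoint_injective ht0.ne'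
    rw [hm0, scaledIntPoint_zero]
  have hfar : ∀ z ∈ bccTemplate s, z ∉ ((winBox i).image fun m => scaledIntPoint (s / Real.sqrt 3) (toVec m)) → z ≠ 0 →
      10 * (sNum i : ℝ) / sNum (i + 1) ≤ ‖z‖ := by
    rintro z ⟨v, hv, rfl⟩ hzW hz0
    have hvm : toVec (v 0, v 1, v 2) = v := toVec_triple v
    have hpar : (v 0, v 1, v 2).1 % 2 = (v 0, v 1, v 2).2.1 % 2 ∧ (v 0, v 1, v 2).2.1 % 2 = (v 0, v 1, v 2).2.2 % 2 := hv
    have hm0 : (v 0, v 1, v 2) ≠ (0 : ℤ × ℤ × ℤ) := by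
      intro h
      apply hz0
      have : v = 0 := by rw [← hvm, h, toVec_zero']
      rw [this, scaledIntPoint_zero]
    have hmW : (v 0, v 1, v 2) ∉ winBox i := fun h =>
      hzW (mem_image_winBox.mpr ⟨(v 0, v 1, v 2), h, by rw [hvm]⟩)
    have hfarZ := far_of_not_mem_winBox hpar hm0 hmW
    have hfarR : (100 : ℝ) * (3 * (sDen : ℝ) * sDen) ≤ (sNum (i + 1) : ℝ) * sNum (i + 1) * (nsq (v 0, v 1, v 2) : ℝ) := by
      have := (Int.cast_le (R := ℝ)).mpr hfarZ; push_cast at this; exact this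
    have hnsq : ‖scaledIntPoint (s / Real.sqrt 3) v‖ ^ 2 = (s / Real.sqrt 3) ^ 2 * (nsq (v 0, v 1, v 2) : ℝ) := by
      rw [← hvm]; exact norm_sq_toVec _ _
    have hs1' : ((sNum i : ℝ) / sDen) ^ 2 ≤ s ^ 2 := pow_le_pow_left₀ hδ0.le hs1 2
    have e1 : (sNum i : ℝ) ^ 2 ≤ s ^ 2 * (sDen : ℝ) ^ 2 := by
      rw [div_pow, div_le_iff₀ (pow_pos hDpos 2)] at hs1'; exact hs1'
    have hRsq : (10 * (sNum i : ℝ) / sNum (i + 1)) ^ 2 ≤ ‖scaledIntPoint (s / Real.sqrt 3) v‖ ^ 2 := by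
      rw [hnsq, ht2, div_pow, div_le_iff₀ (pow_pos hhi 2)]
      nlinarith [mul_le_mul_of_nonneg_left hfarR (sq_nonneg s)]
    exact (pow_le_pow_iff_left₀ hR0 (norm_nonneg _) two_ne_zero).mp hRsq
  -- window + tail
  have hA := sum_phiT_sub_env_le_two_mul_rootEnergy hδ0 hsep (zero_mem_bccTemplate s) _ hWS h0W hfar hR1 hRδ
  -- the K certificate over ℝ
  have hK := drows_bcc_sound hi hs1 hs2 rfl rfl
  -- (s1): the true window sum is the booked sum
  have hsumW : ∑ z ∈ (winBox i).image (fun m => scaledIntPoint (s / Real.sqrt 3) (toVec m)), phiT (‖z‖ ^ 2) =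
      ∑ m ∈ winBox i, phiT (s ^ 2 * ((nsq m).toNat : ℝ) / 3) := by
    rw [Finset.sum_image fun m _ m' _ h => hfinj h]
    refine Finset.sum_congr rfl fun m _ => ?_
    rw [norm_sq_toVec, ht2]
    have hc : ((nsq m).toNat : ℝ) = (nsq m : ℝ) := by
      have h := Int.toNat_of_nonneg (nsq_nonneg m)
      exact_mod_cast h
    rw [hc]; ring_nf
  have hcov : ∀ m ∈ winBox i, ∃ Dm ∈ H0, sNum (i + 1) * sNum (i + 1) * (Dm.1 : ℤ) < 100 * (3 * sDen * sDen) ∧ (nsq m).toNat = Dm.1 := by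
    intro m hm
    obtain ⟨hbox, hin⟩ := Finset.mem_filter.mp hm
    have hlt : nsq m < 375 := nsq_lt_of_inside hin
    obtain ⟨Dm, hDm, hkey⟩ := List.mem_map.mp (cover_H0 m hbox hlt)
    refine ⟨Dm, hDm, ?_, hkey.symm⟩
    have hD : (Dm.1 : ℤ) = nsq m := by rw [hkey]; exact Int.toNat_of_nonneg (nsq_nonneg m)
    rw [hD]; exact hin
  have hfibW : ∀ Dm ∈ H0, sNum (i + 1) * sNum (i + 1) * (Dm.1 : ℤ) < 100 * (3 * sDen * sDen) →
      ((winBox i).filter fun m => (nsq m).toNat = Dm.1).card = Dm.2 := by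
    intro Dm hDm hP
    have hEq : ((winBox i).filter fun m => (nsq m).toNat = Dm.1) = bccBox.filter fun m => nsq m = (Dm.1 : ℤ) := by
      ext m
      simp only [winBox, Finset.mem_filter]
      constructor
      · rintro ⟨⟨hb, -⟩, hk⟩
        exact ⟨hb, by rw [← hk]; exact (Int.toNat_of_nonneg (nsq_nonneg m)).symm⟩
      · rintro ⟨hb, hk⟩
        refine ⟨⟨hb, by rw [hk]; exact hP⟩, by rw [hk]; exact Int.toNat_natCast Dm.1⟩
    rw [hEq]; exact hfib Dm hDm
  have hreg := sum_key_eq_histogram (fun m : ℤ × ℤ × ℤ => (nsq m).toNat) (fun D : ℕ => phiT (s ^ 2 * (D : ℝ) / 3))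
    (fun D : ℕ => sNum (i + 1) * sNum (i + 1) * (D : ℤ) < 100 * (3 * sDen * sDen)) H0 nodup_H0 (winBox i) hcov hfibW
  rw [hreg] at hsumW
  rw [hsumW] at hA
  linarith

end Summit.AtomisticToContinuum.Crystallization.Theorems.FrustratedLawDichotomyDRowsBccTemplate
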